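import Summits.QuantumFields.BalabanUV.T4Continuum.Support.SubstrateBackgroundTransporters
import Literature.MathematicalPhysics.QuantumFieldTheory.Balaban1983to89.BlockAveraging

/-!
# SUBSTRATE — W-25a = L-E19 PART 1 (structure half, (S1)): THE AVERAGING TOWER `U_j = (blockAvg ℰ)^j V` OF A FINEST CONFIGURATION AS
# «ACCUMULATED CORRECTION × STRAIGHT PRODUCT» — `U_j(c) = corrAcc ℰ V j c · axialTower V j c` at V1 (group) level — and the `dist1`
# bookkeeping of the accumulated correction under a DISPLAYED one-step letter `κ` (typer (ο10) l.23046 ∕ (π2) l.23183 «THIS SHAPE»;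
# t4-dagwriter Q49 l.23035 + (a′) l.23165; NE5 owner g39 «J-avg-reg» l.22995; scope page `substrate/p3/SCOPE-L-E19-AvgTowerReg.md` 7e989fd6f73ba82b)

Cell `pub-balaban`, SUBSTRATE cell, seat `b2b-balaban-substrate-p3` (gen 4).  Summits-side under the LEAN PLACEMENT RULE ([dict] ∕ [folklore]
bookkeeping on V1 objects; nothing printed is asserted; no citation tags; no `Prop`-valued fact minted).  PART 2 (`SubstrateAvgTowerPlumbing`:
the scalar tower `towerOfS` with its ties to `towerOf` ∕ `towerDataOf`, and the plumbing (S3) of the letters (ℓ1)–(ℓ4) into NE5's binders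
`hreg` ∕ `hloc`) imports this file; the split is for the 300-line rider (σ4).

WHY.  NE5's W1 chain of record (g38-c `B13ReadingsRecordRate` p239282, re-pointed by W-21c `SubstrateO1ReadingsShiftRate` p239614) consumes, per
background, (ℓ1) levelwise `RegularTransporters` and row NE2's `LocalRate` binder built from (ℓ1)–(ℓ4) by `NE2FromNE3BavgBridge`; for row NE5
(E-avg) the towers are Bałaban's AVERAGING TOWERS `(blockAvg ℰ)^j V` of the real fine fields `V : GaugeField P 0 G` (V1 level `j` = NE2 level `K − j`).
The NE5 owner's abstract lemmas g39-a (`B13ReadingsLineProducts` ∕ `B13ReadingsAvgTowerDirect`, STAGED l.23219) derive (ℓ1)(ℓ3) from a displayed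
STRUCTURE `R k μ i = C · lprod (…) L` plus a correction letter `‖C − 1‖ ≤ κ∕ℓ²`; the k-UNIFORM (ℓ1) needs the TOTAL correction of the multi-level
factorisation (owner's note (i), l.23219).  THIS FILE supplies both AT THE DATUM: the one-step structure is `avgFun ℰ U c = corr ℰ U c * axialAvg U c`
(`BlockAveraging` l.798, definitional), the total one is `corrAcc`, and `dist1 (corrAcc) ≤ 2κ∕ℓ²` is GEOMETRIC because the group's `dist1` is
conjugation-invariant and subadditive (no `e^{2κ}`).

WHAT.  §1 GROUP ALGEBRA ([folklore], any `[GaugeGroup G]`): `pprod`, the CONJUGATED ACCUMULATION `conjAcc C A n = Π_{t<n} (P_t·C_t·P_t⁻¹)`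
(`P_t = pprod A t`), **`pprod_mul_eq_conjAcc_mul_pprod`** (`Π_{t<n}(C_t·A_t) = conjAcc C A n · Π_{t<n} A_t`), **`dist1_conjAcc_le`** (`≤ Σ_{t<n} dist1 C_t`).
§2 THE TOWERS (V1): `avgTower ℰ V j := (blockAvg ℰ)^j V`, `axialTower V j := (axial)^j V` (the straight product of the `L^j` finest bonds under a
level-`j` bond), `avgTower_succ` ∕ `axialTower_succ` (rfl), the ACCUMULATED CORRECTION `corrAcc ℰ V j c` and **`avgTower_eq_corrAcc_mul_axialTower`**
(`U_j(c) = corrAcc ℰ V j c · (axial)^j V (c)`); `dist1` BOOKKEEPING: **`dist1_corrAcc_succ_le`**, the PRIMARY un-scaled form **`dist1_corrAcc_le_accBound`**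
(`hκ : dist1 (corr ℰ U_i c) ≤ κ i` ⟹ `≤ accBound L κ j`, `accBound L κ (j+1) = κ j + L·accBound L κ j`), the SCALED corollaries **`dist1_corrAcc_scaled_le`**
(`i + 1 + k = K`, `dist1 (corr ℰ U_i c)·ℓ_k² ≤ κ` ⟹ `dist1 (corrAcc ℰ V j c)·ℓ_k² ≤ 2κ` at `j + k = K`, `L ≥ 2`) and **`dist1_corrAcc_le_of_hκ`** (the scope
page's literal display `hκ : ∀ i < K, dist1 (corr …) ≤ κ∕(L^(K−1−i))²` ⟹ `dist1 (corrAcc ℰ V j c) ≤ 2κ∕(L^(K−j))²`, `j ≤ K`); the straight factor: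
**`dist1_axialTower_le`** (`≤ L^j·a`), **`dist1_axialTower_scaled_le`** (`L^K·dist1 (V b) ≤ α′ ⟹ ℓ_k·dist1 ((axial)^j V c) ≤ α′`), and the group-level
SIZE reading **`dist1_avgTower_scaled_le`** (`ℓ_k·dist1 (U_j c) ≤ α′ + 2κ∕ℓ_k` — the `dist1`-currency of (ℓ1)'s size half; the matrix currency
`‖L^k(R − 1)‖` follows through any `ι` with `‖ι g − 1‖ = dist1 g` in W-25b).

HONEST FRAMING: rung (B)+1 of the FINITE-VOLUME T⁴ programme — NOT infinite volume, NOT a mass gap, NOT Clay; spine PROVED 0∕9; NE5 ∕ NE2 NOT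
PRINTED ∕ NOT PROVED.  Group algebra at the datum only; NO estimate is proved here: the one-step letter `κ` is DISPLAYED — its discharge for
`ℰ = expMeanLogSU` (a torus non-abelian Stokes bound for `loopHol`) is the NE5 owner lineage's per t4-dagwriter Q49 (a′) l.23165, NOT the
substrate's, and b07's ℤ^d `B7Prop1Explicit.prop1_explicit` does NOT transport by name (scope page §3); (ℓ1)(ℓ3) in the MATRIX currency are
W-25b's (ON EVENT g39-a), (ℓ2)(ℓ4) stay displayed letters (row NE2 ROOT-B, Q49 (b)).  Nothing of [Balaban1985Averaging] Props 1–4 ∕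
[Balaban1987RG1] (0.4) is discharged.  HONEST DEPENDENCY (cell line, verbatim): continuum YM on T⁴ ⇐ BetaPertH ∧ nine spine estimates (0/9 proved);
BetaPertH ⇐ (D1) ∧ (D4) ∧ CAP+tail; G-an2-4 gates asym, D1 and NE2/3/4.  0 sorry; axioms ⊆ {propext, Classical.choice, Quot.sound}.
-/

noncomputable section

open scoped BigOperators

namespace Summit.QuantumFields.BalabanUV.T4Continuum.SubstrateAvgTowerStructure

open Literature.MathematicalPhysics.QuantumFieldTheory.Balaban1983to89
open Literature.MathematicalPhysics.QuantumFieldTheory.Balaban1983to89.B5G183RateUnitTower (lev lev_neZero)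
open Literature.MathematicalPhysics.QuantumFieldTheory.Balaban1983to89.BlockAveraging (corr avgFun blockAvg)
open Literature.MathematicalPhysics.QuantumFieldTheory.Balaban1983to89.AveragingRT (line pathProd axialAvg axial)
open Summit.QuantumFields.BalabanUV.T4Continuum
open Summit.QuantumFields.BalabanUV.T4Continuum.BalabanAveragedTowerUnit (lev_succ' cast_lev' one_le_lev')

/-! ## §1 Group algebra: partial products and the conjugated accumulation -/

section Group

variable {G : Type*} [GaugeGroup G]

/-- [folklore] the ordered partial product `pprod A n = A 0 · A 1 ⋯ A (n−1)` (`pprod A 0 = 1`). -/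
def pprod (A : ℕ → G) : ℕ → G
  | 0 => 1
  | n + 1 => pprod A n * A n

/-- [folklore] `pprod` unfolds. -/ @[simp] theorem pprod_zero (A : ℕ → G) : pprod A 0 = 1 := rfl

/-- [folklore] `pprod` unfolds. -/ theorem pprod_succ (A : ℕ → G) (n : ℕ) : pprod A (n + 1) = pprod A n * A n := rfl

/-- [folklore] **THE CONJUGATED ACCUMULATION** `conjAcc C A n = Π_{t<n} (P_t·C_t·P_t⁻¹)`, `P_t = pprod A t`: the factor collecting the `C_t`'s when they
are pulled to the LEFT through the partial products of the `A_t`'s. -/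
def conjAcc (C A : ℕ → G) : ℕ → G
  | 0 => 1
  | n + 1 => conjAcc C A n * (pprod A n * C n * (pprod A n)⁻¹)

/-- [folklore] `conjAcc` unfolds. -/ @[simp] theorem conjAcc_zero (C A : ℕ → G) : conjAcc C A 0 = 1 := rfl

/-- [folklore] `conjAcc` unfolds. -/ theorem conjAcc_succ (C A : ℕ → G) (n : ℕ) : conjAcc C A (n + 1) = conjAcc C A n * (pprod A n * C n * (pprod A n)⁻¹) := rfl

/-- [folklore] **PULLING THE CORRECTIONS THROUGH**: `Π_{t<n} (C_t·A_t) = conjAcc C A n · Π_{t<n} A_t`. -/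
theorem pprod_mul_eq_conjAcc_mul_pprod (C A : ℕ → G) : ∀ n, pprod (fun t => C t * A t) n = conjAcc C A n * pprod A n
  | 0 => by rw [pprod_zero, pprod_zero, conjAcc_zero, one_mul]
  | n + 1 => by
      rw [pprod_succ, pprod_succ, conjAcc_succ, pprod_mul_eq_conjAcc_mul_pprod C A n]
      group

/-- [folklore] `dist1 (Π_{t<n} A_t) ≤ Σ_{t<n} dist1 (A_t)` (`dist1_mul_le`). -/
theorem dist1_pprod_le (A : ℕ → G) : ∀ n, dist1 (pprod A n) ≤ ∑ t ∈ Finset.range n, dist1 (A t)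
  | 0 => by rw [pprod_zero, GaugeGroup.dist1_one, Finset.sum_range_zero]
  | n + 1 => by
      rw [pprod_succ, Finset.sum_range_succ]
      exact (GaugeGroup.dist1_mul_le _ _).trans (add_le_add (dist1_pprod_le A n) le_rfl)

/-- [folklore] **`dist1 (conjAcc C A n) ≤ Σ_{t<n} dist1 (C_t)`** — conjugation does not change `dist1` (`dist1_conj`), products are subadditive
(`dist1_mul_le`); the straight factors `A_t` do not enter. -/
theorem dist1_conjAcc_le (C A : ℕ → G) : ∀ n, dist1 (conjAcc C A n) ≤ ∑ t ∈ Finset.range n, dist1 (C t)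
  | 0 => by rw [conjAcc_zero, GaugeGroup.dist1_one, Finset.sum_range_zero]
  | n + 1 => by
      rw [conjAcc_succ, Finset.sum_range_succ]
      exact (GaugeGroup.dist1_mul_le _ _).trans (add_le_add (dist1_conjAcc_le C A n) (le_of_eq (GaugeGroup.dist1_conj _ _)))

end Group

/-! ## §2 The averaging tower of a finest configuration as «accumulated correction × straight product» -/

section Towers

variable {P : Params} {G : Type*} [GaugeGroup G] (ℰ : LoopAverage G)

/-- [folklore] **THE AVERAGING TOWER** of a finest configuration: `U_j = (blockAvg ℰ)^j V` on `T^{(j)}` (`Averaging.iter` of `Setup`). -/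
abbrev avgTower (V : GaugeField P 0 G) (j : ℕ) : GaugeField P j G := Averaging.iter (fun i => (blockAvg ℰ : Averaging P i G)) j V

/-- [folklore] **THE AXIAL TOWER**: `(axial)^j V` — the straight product of the `L^j` finest bonds under each level-`j` bond (`AveragingRT.axial`). -/
abbrev axialTower (V : GaugeField P 0 G) (j : ℕ) : GaugeField P j G := Averaging.iter (fun i => (axial : Averaging P i G)) j V

/-- [folklore] one more block-averaging step: `U_{j+1}(c) = corr ℰ U_j c · Π_{t<L} U_j(line c t)` (`avgFun`, definitional). -/
theorem avgTower_succ (V : GaugeField P 0 G) (j : ℕ) (c : PBond P (j + 1)) :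
    avgTower ℰ V (j + 1) c = corr ℰ (avgTower ℰ V j) c * pathProd (avgTower ℰ V j) c P.L := rfl

/-- [folklore] one more axial step: `(axial)^{j+1} V (c) = Π_{t<L} (axial)^j V (line c t)` (definitional). -/
theorem axialTower_succ (V : GaugeField P 0 G) (j : ℕ) (c : PBond P (j + 1)) :
    axialTower V (j + 1) c = pathProd (axialTower V j) c P.L := rfl

/-- [folklore] `pathProd` IS the ordered partial product along the line of `c`. -/
theorem pathProd_eq_pprod {j : ℕ} (U : GaugeField P j G) (c : PBond P (j + 1)) : ∀ n, pathProd U c n = pprod (fun t => U (line c t)) n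
  | 0 => rfl
  | n + 1 => by rw [pprod_succ, ← pathProd_eq_pprod U c n]; rfl

/-- [folklore] `dist1` along a line: `dist1 (pathProd U c n) ≤ Σ_{t<n} dist1 (U (line c t))`. -/
theorem dist1_pathProd_le {j : ℕ} (U : GaugeField P j G) (c : PBond P (j + 1)) (n : ℕ) :
    dist1 (pathProd U c n) ≤ ∑ t ∈ Finset.range n, dist1 (U (line c t)) := by
  rw [pathProd_eq_pprod]; exact dist1_pprod_le _ n

/-- [folklore] **THE ACCUMULATED CORRECTION** `corrAcc ℰ V j c ∈ G`: `corrAcc 0 = 1`; `corrAcc (j+1) c = corr ℰ (U_j) c · conjAcc (t ↦ corrAcc j (line c t))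
(t ↦ (axial)^j V (line c t)) L` — the level-`(j+1)` one-step factor times the level-`≤ j` factors met along the line of `c`, pulled to the left through the
straight products. -/
def corrAcc (V : GaugeField P 0 G) : (j : ℕ) → PBond P j → G
  | 0 => fun _ => 1
  | j + 1 => fun c => corr ℰ (avgTower ℰ V j) c *
      conjAcc (fun t => corrAcc V j (line c t)) (fun t => axialTower V j (line c t)) P.L

/-- [folklore] `corrAcc` unfolds at level `0`. -/ @[simp] theorem corrAcc_zero (V : GaugeField P 0 G) (b : PBond P 0) : corrAcc ℰ V 0 b = 1 := rfl

/-- [folklore] `corrAcc` unfolds at a successor level. -/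
theorem corrAcc_succ (V : GaugeField P 0 G) (j : ℕ) (c : PBond P (j + 1)) :
    corrAcc ℰ V (j + 1) c = corr ℰ (avgTower ℰ V j) c *
      conjAcc (fun t => corrAcc ℰ V j (line c t)) (fun t => axialTower V j (line c t)) P.L := rfl

/-- [folklore] **THE AVERAGING TOWER IS «ACCUMULATED CORRECTION × STRAIGHT PRODUCT»**: `(blockAvg ℰ)^j V (c) = corrAcc ℰ V j c · (axial)^j V (c)` for every
level `j` and every bond `c` of `T^{(j)}` — the direct representation `R^{(k)}(c) = C(c)·S(c)` AT THE DATUM (after `ι`: `towerOfS_avgTower_chart`). -/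
theorem avgTower_eq_corrAcc_mul_axialTower (V : GaugeField P 0 G) : ∀ (j : ℕ) (c : PBond P j), avgTower ℰ V j c = corrAcc ℰ V j c * axialTower V j c
  | 0, c => by rw [corrAcc_zero, one_mul]; rfl
  | j + 1, c => by
      have e1 : pathProd (avgTower ℰ V j) c P.L = pprod (fun t => corrAcc ℰ V j (line c t) * axialTower V j (line c t)) P.L := by
        rw [pathProd_eq_pprod]
        congr 1; funext t; exact avgTower_eq_corrAcc_mul_axialTower V j (line c t)
      rw [avgTower_succ, corrAcc_succ, axialTower_succ, e1, pprod_mul_eq_conjAcc_mul_pprod, pathProd_eq_pprod, mul_assoc]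

/-- [folklore] **ONE-STEP RECURSION OF THE `dist1` BUDGET**: `dist1 (corrAcc (j+1) c) ≤ dist1 (corr ℰ U_j c) + Σ_{t<L} dist1 (corrAcc j (line c t))`. -/
theorem dist1_corrAcc_succ_le (V : GaugeField P 0 G) (j : ℕ) (c : PBond P (j + 1)) :
    dist1 (corrAcc ℰ V (j + 1) c) ≤ dist1 (corr ℰ (avgTower ℰ V j) c) + ∑ t ∈ Finset.range P.L, dist1 (corrAcc ℰ V j (line c t)) := by
  rw [corrAcc_succ]
  exact (GaugeGroup.dist1_mul_le _ _).trans (add_le_add le_rfl (dist1_conjAcc_le _ _ _))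

/-- [folklore] the accumulated budget `accBound L κ 0 = 0`, `accBound L κ (j+1) = κ j + L·accBound L κ j` (= `Σ_{i<j} L^{j−1−i}·κ i`). -/
def accBound (L : ℕ) (κ : ℕ → ℝ) : ℕ → ℝ
  | 0 => 0
  | j + 1 => κ j + L * accBound L κ j

/-- [folklore] **THE ACCUMULATED CORRECTION UNDER A DISPLAYED ONE-STEP LETTER**: if every one-step factor at V1 step `i → i+1` has `dist1 ≤ κ i` (for all
bonds), then `dist1 (corrAcc ℰ V j c) ≤ accBound L κ j`, uniformly in `c`. -/
theorem dist1_corrAcc_le_accBound (V : GaugeField P 0 G) {κ : ℕ → ℝ} (hκ : ∀ (i : ℕ) (c : PBond P (i + 1)), dist1 (corr ℰ (avgTower ℰ V i) c) ≤ κ i) :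
    ∀ (j : ℕ) (c : PBond P j), dist1 (corrAcc ℰ V j c) ≤ accBound P.L κ j
  | 0, c => by rw [corrAcc_zero, GaugeGroup.dist1_one]; exact le_rfl
  | j + 1, c => by
      refine (dist1_corrAcc_succ_le ℰ V j c).trans ?_
      show _ ≤ κ j + P.L * accBound P.L κ j
      refine add_le_add (hκ j c) ?_
      calc ∑ t ∈ Finset.range P.L, dist1 (corrAcc ℰ V j (line c t)) ≤ ∑ _t ∈ Finset.range P.L, accBound P.L κ j :=
            Finset.sum_le_sum fun t _ => dist1_corrAcc_le_accBound V hκ j _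
        _ = P.L * accBound P.L κ j := by rw [Finset.sum_const, Finset.card_range, nsmul_eq_mul]

/-- [folklore] **THE SCALED FORM (the owner's `2κ∕ℓ²`, l.22995 (i), WITHOUT `e^{2κ}`)**: index the V1 step `i → i+1` by the NE2 level `k` of its COARSE lattice
(`i + 1 + k = K`, `ℓ_k = lev L k = L^k`); if every one-step factor has `dist1 (corr ℰ U_i c)·ℓ_k² ≤ κ` (`κ ≥ 0`) and `L ≥ 2`, then at every level `j + k = K`:
`dist1 (corrAcc ℰ V j c)·ℓ_k² ≤ 2κ` (the recursion `E_{j+1} ≤ κ + E_j∕L`). -/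
theorem dist1_corrAcc_scaled_le (hL : 2 ≤ P.L) (V : GaugeField P 0 G) {κ : ℝ} (hκ0 : 0 ≤ κ)
    (hκ : ∀ (i k : ℕ), i + 1 + k = P.K → ∀ c : PBond P (i + 1), dist1 (corr ℰ (avgTower ℰ V i) c) * ((lev P.L k : ℕ) : ℝ) ^ 2 ≤ κ) :
    ∀ (j k : ℕ), j + k = P.K → ∀ c : PBond P j, dist1 (corrAcc ℰ V j c) * ((lev P.L k : ℕ) : ℝ) ^ 2 ≤ 2 * κ
  | 0, k, _, c => by rw [corrAcc_zero, GaugeGroup.dist1_one, zero_mul]; positivity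
  | j + 1, k, hjk, c => by
      have hL0 : (0 : ℝ) < P.L := by exact_mod_cast P.L_pos
      have hL2 : (2 : ℝ) ≤ P.L := by exact_mod_cast hL
      have hℓ : (0 : ℝ) < (lev P.L k : ℕ) := by exact_mod_cast one_le_lev' P.L k
      have IH : ∀ t, dist1 (corrAcc ℰ V j (line c t)) * ((lev P.L (k + 1) : ℕ) : ℝ) ^ 2 ≤ 2 * κ :=
        fun t => dist1_corrAcc_scaled_le hL V hκ0 hκ j (k + 1) (by omega) _
      have hstep := hκ j k hjk c
      -- `dist1 (corrAcc j (line c t))·ℓ_k² ≤ 2κ∕L²`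
      have hline : ∀ t, dist1 (corrAcc ℰ V j (line c t)) * ((lev P.L k : ℕ) : ℝ) ^ 2 ≤ 2 * κ / (P.L : ℝ) ^ 2 := by
        intro t
        have h := IH t
        rw [lev_succ', Nat.cast_mul, mul_pow] at h
        rw [le_div_iff₀ (by positivity)]
        calc dist1 (corrAcc ℰ V j (line c t)) * ((lev P.L k : ℕ) : ℝ) ^ 2 * (P.L : ℝ) ^ 2
            = dist1 (corrAcc ℰ V j (line c t)) * ((P.L : ℝ) ^ 2 * ((lev P.L k : ℕ) : ℝ) ^ 2) := by ring
          _ ≤ 2 * κ := h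
      have h1 := dist1_corrAcc_succ_le ℰ V j c
      have h2κ : 2 * κ / (P.L : ℝ) ≤ κ := by rw [div_le_iff₀ hL0]; nlinarith
      calc dist1 (corrAcc ℰ V (j + 1) c) * ((lev P.L k : ℕ) : ℝ) ^ 2
          ≤ (dist1 (corr ℰ (avgTower ℰ V j) c) + ∑ t ∈ Finset.range P.L, dist1 (corrAcc ℰ V j (line c t))) * ((lev P.L k : ℕ) : ℝ) ^ 2 :=
            mul_le_mul_of_nonneg_right h1 (by positivity)
        _ = dist1 (corr ℰ (avgTower ℰ V j) c) * ((lev P.L k : ℕ) : ℝ) ^ 2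
              + ∑ t ∈ Finset.range P.L, dist1 (corrAcc ℰ V j (line c t)) * ((lev P.L k : ℕ) : ℝ) ^ 2 := by rw [add_mul, Finset.sum_mul]
        _ ≤ κ + ∑ _t ∈ Finset.range P.L, 2 * κ / (P.L : ℝ) ^ 2 := add_le_add hstep (Finset.sum_le_sum fun t _ => hline t)
        _ = κ + (P.L : ℝ) * (2 * κ / (P.L : ℝ) ^ 2) := by rw [Finset.sum_const, Finset.card_range, nsmul_eq_mul]
        _ = κ + 2 * κ / (P.L : ℝ) := by rw [pow_two, ← mul_div_assoc, mul_div_mul_left _ _ hL0.ne']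
        _ ≤ 2 * κ := by linarith

/-- [folklore] **THE SCOPE PAGE's LITERAL DISPLAY** (rider (σ2) of typer (π2)): `hκ : ∀ i < K, ∀ c, dist1 (corr ℰ U_i c) ≤ κ∕(L^(K−1−i))²` (`κ ≥ 0`, `L ≥ 2`)
gives `dist1 (corrAcc ℰ V j c) ≤ 2κ∕(L^(K−j))²` at every V1 level `j ≤ K` — a corollary of the `k`-indexed `dist1_corrAcc_scaled_le`. -/
theorem dist1_corrAcc_le_of_hκ (hL : 2 ≤ P.L) (V : GaugeField P 0 G) {κ : ℝ} (hκ0 : 0 ≤ κ)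
    (hκ : ∀ i < P.K, ∀ c : PBond P (i + 1), dist1 (corr ℰ (avgTower ℰ V i) c) ≤ κ / ((P.L : ℝ) ^ (P.K - 1 - i)) ^ 2)
    {j : ℕ} (hj : j ≤ P.K) (c : PBond P j) : dist1 (corrAcc ℰ V j c) ≤ 2 * κ / ((P.L : ℝ) ^ (P.K - j)) ^ 2 := by
  have hL0 : (0 : ℝ) < P.L := by exact_mod_cast P.L_pos
  have hκ' : ∀ (i k : ℕ), i + 1 + k = P.K → ∀ c : PBond P (i + 1), dist1 (corr ℰ (avgTower ℰ V i) c) * ((lev P.L k : ℕ) : ℝ) ^ 2 ≤ κ := by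
    intro i k hik c
    have h := hκ i (by omega) c
    have hk : P.K - 1 - i = k := by omega
    have hℓ : (0 : ℝ) < ((lev P.L k : ℕ) : ℝ) ^ 2 := pow_pos (by exact_mod_cast one_le_lev' P.L k) 2
    rw [hk, ← cast_lev', le_div_iff₀ hℓ] at h
    exact h
  have h := dist1_corrAcc_scaled_le ℰ hL V hκ0 hκ' j (P.K - j) (by omega) c
  rw [cast_lev'] at h
  rw [le_div_iff₀ (pow_pos (pow_pos hL0 _) 2)]
  exact h

/-- [folklore] **SIZE OF THE STRAIGHT FACTOR**: if every finest bond has `dist1 ≤ a` then `dist1 ((axial)^j V (c)) ≤ L^j·a`. -/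
theorem dist1_axialTower_le (V : GaugeField P 0 G) {a : ℝ} (hV : ∀ b : PBond P 0, dist1 (V b) ≤ a) :
    ∀ (j : ℕ) (c : PBond P j), dist1 (axialTower V j c) ≤ (P.L : ℝ) ^ j * a
  | 0, c => by rw [pow_zero, one_mul]; exact hV c
  | j + 1, c => by
      rw [axialTower_succ]
      calc dist1 (pathProd (axialTower V j) c P.L) ≤ ∑ t ∈ Finset.range P.L, dist1 (axialTower V j (line c t)) := dist1_pathProd_le _ c P.L
        _ ≤ ∑ _t ∈ Finset.range P.L, (P.L : ℝ) ^ j * a := Finset.sum_le_sum fun t _ => dist1_axialTower_le V hV j _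
        _ = (P.L : ℝ) ^ (j + 1) * a := by rw [Finset.sum_const, Finset.card_range, nsmul_eq_mul, pow_succ]; ring

/-- [folklore] **THE SCALED SIZE OF THE STRAIGHT FACTOR**: the finest size letter `L^K·dist1 (V b) ≤ α′` gives `ℓ_k·dist1 ((axial)^j V (c)) ≤ α′` at every level
`j + k = K` — UNIFORM in the level. -/
theorem dist1_axialTower_scaled_le (V : GaugeField P 0 G) {α' : ℝ} (hV : ∀ b : PBond P 0, (P.L : ℝ) ^ P.K * dist1 (V b) ≤ α') {j k : ℕ} (hjk : j + k = P.K)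
    (c : PBond P j) : ((lev P.L k : ℕ) : ℝ) * dist1 (axialTower V j c) ≤ α' := by
  have hL0 : (0 : ℝ) < P.L := by exact_mod_cast P.L_pos
  have hK : (0 : ℝ) < (P.L : ℝ) ^ P.K := pow_pos hL0 _
  have hV' : ∀ b : PBond P 0, dist1 (V b) ≤ α' / (P.L : ℝ) ^ P.K := fun b => by rw [le_div_iff₀ hK, mul_comm]; exact hV b
  have h := dist1_axialTower_le V hV' j c
  rw [cast_lev']
  calc (P.L : ℝ) ^ k * dist1 (axialTower V j c) ≤ (P.L : ℝ) ^ k * ((P.L : ℝ) ^ j * (α' / (P.L : ℝ) ^ P.K)) :=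
        mul_le_mul_of_nonneg_left h (pow_nonneg hL0.le _)
    _ = α' := by rw [← hjk, pow_add]; field_simp

/-- [folklore] **THE GROUP-LEVEL SIZE READING OF THE AVERAGING TOWER** under the two displayed letters (finest size `α′`, one-step corrections `κ∕ℓ²`):
`ℓ_k·dist1 ((blockAvg ℰ)^j V (c)) ≤ α′ + 2κ∕ℓ_k` at every `j + k = K` (`L ≥ 2`) — UNIFORM in the level (the `dist1`-currency of (ℓ1)'s size half; the
matrix currency `‖L^k(R − 1)‖` follows through any `ι` with `‖ι g − 1‖ = dist1 g`, W-25b). -/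
theorem dist1_avgTower_scaled_le (hL : 2 ≤ P.L) (V : GaugeField P 0 G) {α' κ : ℝ} (hκ0 : 0 ≤ κ)
    (hV : ∀ b : PBond P 0, (P.L : ℝ) ^ P.K * dist1 (V b) ≤ α')
    (hκ : ∀ (i k : ℕ), i + 1 + k = P.K → ∀ c : PBond P (i + 1), dist1 (corr ℰ (avgTower ℰ V i) c) * ((lev P.L k : ℕ) : ℝ) ^ 2 ≤ κ)
    {j k : ℕ} (hjk : j + k = P.K) (c : PBond P j) :
    ((lev P.L k : ℕ) : ℝ) * dist1 (avgTower ℰ V j c) ≤ α' + 2 * κ / ((lev P.L k : ℕ) : ℝ) := by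
  have hℓ : (0 : ℝ) < (lev P.L k : ℕ) := by exact_mod_cast one_le_lev' P.L k
  have h1 := dist1_corrAcc_scaled_le ℰ hL V hκ0 hκ j k hjk c
  have h2 := dist1_axialTower_scaled_le V hV hjk c
  have h3 : ((lev P.L k : ℕ) : ℝ) * dist1 (corrAcc ℰ V j c) ≤ 2 * κ / ((lev P.L k : ℕ) : ℝ) := by
    rw [le_div_iff₀ hℓ]; nlinarith
  rw [avgTower_eq_corrAcc_mul_axialTower]
  calc ((lev P.L k : ℕ) : ℝ) * dist1 (corrAcc ℰ V j c * axialTower V j c)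
      ≤ ((lev P.L k : ℕ) : ℝ) * (dist1 (corrAcc ℰ V j c) + dist1 (axialTower V j c)) :=
        mul_le_mul_of_nonneg_left (GaugeGroup.dist1_mul_le _ _) hℓ.le
    _ ≤ 2 * κ / ((lev P.L k : ℕ) : ℝ) + α' := by rw [mul_add]; exact add_le_add h3 h2
    _ = α' + 2 * κ / ((lev P.L k : ℕ) : ℝ) := add_comm _ _

end Towers

end Summit.QuantumFields.BalabanUV.T4Continuum.SubstrateAvgTowerStructure

end
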